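import Literature.NumberTheory.Automorphic.ArchGardingWhittaker
import Literature.NumberTheory.Automorphic.ArchUnipotentDilationGL2
import Literature.NumberTheory.Automorphic.GLnCornerEmbedding
import Literature.Analysis.UnboundedOperators.UnitaryRepSpectralMeasure
import HarnessLib

/-!
# The last-column group `U_{m+1} ≅ K_∞^m` of `GL_{m+1}(K_∞)` inside a unitary representation:
# the unitary representation of the column, and the covariance of its spectral measures under the corner `GL_m`

Topic `NumberTheory/Automorphic`; namespace `Literature.NumberTheory.Automorphic`. Definitions with
bodies and theorems (no named fact). This is the first brick of the Mackey analysis of the mirabolic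
subgroup `P_{m+1} = GL_m ⋉ U_{m+1}` of `G_∞ = GL_{m+1}(K_∞)` (`K_∞ = mixedSpace K`) inside a unitary
strongly continuous representation `τ` (Jacquet–Shalika (1981), §3, (3.5)–(3.8): the representation
`τ_r = Ind(P_r, N_r; θ_r)` and the restriction of `π` to `P_r`; Folland (1995), §6.4 for the semidirect
product `GL_m ⋉ ℝ^m`), in every rank:

* `lastColMatrix x = Σ_i x_i E_{i, m+1}` (`i ≤ m`) and the column group
  `archColGL x = 1 + lastColMatrix x ∈ GL_{m+1}(K_∞)` (`= exp`, the square being `0`), additive in `x`,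
  conjugated by the corner `diag(g, 1) = GLn.cornerSucc g` through `x ↦ g x`
  (`cornerSucc_mul_archColGL_mul_inv`);
* `archColHom hcpt : K_∞^m →ₜ* G_∞` and, for `τ` unitary strongly continuous,
  `archColRep hτ hτu : UnitaryRep (Multiplicative (Fin m → K_∞)) E` — the unitary representation of the
  column (`archColRep_apply : archColRep (ofAdd x) = τ(u(x))`);
* `archColForm K m`, the non-degenerate real bilinear form `B_m(ξ, x) = Σ_i B(ξ_i, x_i)` on `K_∞^m`
  built from Tate's character form `B = archCharForm K` (so that the characters of `K_∞^m` are
  `x ↦ exp(i B_m(ξ, x))`, `ξ` a ROW vector), with `B_m(ξ, g x) = B_m(ξ g, x)` (`archColForm_mulVec`);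
* **covariance**: `⟪τ(diag(g,1)) v, τ(u(x)) τ(diag(g,1)) v⟫ = ⟪v, τ(u(g⁻¹ x)) v⟫`
  (`matrixCoeff_archColRep_cornerSucc`), hence the spectral measure (Stone–Bochner,
  `UnitaryRep.spectralMeasure`) of `τ(diag(g,1)) v` for the column is the push-forward of that of `v`
  under the row action `ξ ↦ ξ g⁻¹` (`spectralMeasure_archColRep_cornerSucc`): the corner `GL_m` moves
  column frequencies by `ξ ↦ ξ g⁻¹`, with the open orbit of the generic frequency `e_m` — the system of
  imprimitivity underlying the Kirillov model in rank `m + 1`.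

## References

* H. Jacquet, J. A. Shalika, *On Euler products and the classification of automorphic
  representations I*, Amer. J. Math. 103 (1981), §3, (3.5)–(3.8) [JacquetShalikaAJM1981].
* G. B. Folland, *A Course in Abstract Harmonic Analysis* (1995), §4.4 (Thm. 4.44), §6.4
  [Folland1995].
-/

noncomputable section

open MeasureTheory NumberField NumberField.mixedEmbedding Matrix
open scoped MatrixGroups InnerProductSpace Classical

namespace Literature.NumberTheory.Automorphic

open Literature.Analysis.UnboundedOperators

variable {K : Type} [Field K] [NumberField K] {m : ℕ}

/-! ### 1. The last column as matrices -/

section Matrices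

variable {R : Type*} [CommRing R]

/-- **The last-column matrix** `N(x) = Σ_{i ≤ m} x_i E_{i, m+1}` of `M_{m+1}(R)`: the entries
`(i, m+1)` for `i ≤ m` are the `x_i`, all others vanish. [cite: JacquetShalikaAJM1981, §3, (3.5)] -/
def lastColMatrix (x : Fin m → R) : Matrix (Fin (m + 1)) (Fin (m + 1)) R :=
  Matrix.of fun i j => if h : i ≠ Fin.last m ∧ j = Fin.last m then x (i.castPred h.1) else 0

/-- Entries of `N(x)` in the last column, above the corner: `N(x)_{i, m+1} = x_i`. [folklore] -/
@[simp] theorem lastColMatrix_castSucc_last (x : Fin m → R) (i : Fin m) :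
    lastColMatrix x i.castSucc (Fin.last m) = x i := by
  simp [lastColMatrix, Fin.castSucc_ne_last]

/-- The last row of `N(x)` vanishes. [folklore] -/
@[simp] theorem lastColMatrix_last (x : Fin m → R) (j : Fin (m + 1)) : lastColMatrix x (Fin.last m) j = 0 := by
  simp [lastColMatrix]

/-- Entries of `N(x)` off the last column vanish. [folklore] -/
@[simp] theorem lastColMatrix_castSucc_castSucc (x : Fin m → R) (i j : Fin m) :
    lastColMatrix x i.castSucc j.castSucc = 0 := by
  simp [lastColMatrix, Fin.castSucc_ne_last]

/-- Entries of `N(x)` off the last column vanish (unbundled column index). [folklore] -/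
theorem lastColMatrix_apply_of_ne (x : Fin m → R) (i : Fin (m + 1)) {j : Fin (m + 1)} (hj : j ≠ Fin.last m) :
    lastColMatrix x i j = 0 := by
  simp [lastColMatrix, hj]

/-- `N` is additive. [folklore] -/
theorem lastColMatrix_add (x y : Fin m → R) : lastColMatrix (x + y) = lastColMatrix x + lastColMatrix y := by
  ext i j
  simp only [lastColMatrix, Matrix.of_apply, Matrix.add_apply, Pi.add_apply]
  split_ifs <;> simp

/-- `N(0) = 0`. [folklore] -/
@[simp] theorem lastColMatrix_zero : lastColMatrix (0 : Fin m → R) = 0 := by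
  ext i j
  simp only [lastColMatrix, Matrix.of_apply, Matrix.zero_apply, Pi.zero_apply]
  split_ifs <;> simp

/-- `N(x) N(y) = 0` (the last column is an abelian Lie algebra of square zero). [folklore] -/
theorem lastColMatrix_mul_lastColMatrix (x y : Fin m → R) : lastColMatrix x * lastColMatrix y = 0 := by
  ext i j
  rw [Matrix.mul_apply, Matrix.zero_apply]
  refine Finset.sum_eq_zero fun k _ => ?_
  by_cases hk : k = Fin.last m
  · rw [hk, lastColMatrix_last, mul_zero]
  · rw [lastColMatrix_apply_of_ne x i hk, zero_mul]

/-- `(1 + N(x)) (1 + N(y)) = 1 + N(x + y)`. [folklore] -/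
theorem one_add_lastColMatrix_mul (x y : Fin m → R) :
    (1 + lastColMatrix x) * (1 + lastColMatrix y) = 1 + lastColMatrix (x + y) := by
  rw [add_mul, mul_add, mul_add, one_mul, mul_one, one_mul, lastColMatrix_mul_lastColMatrix, add_zero,
    lastColMatrix_add]
  abel

/-- **The column group element** `u(x) = 1 + N(x) ∈ GL_{m+1}(R)`, with inverse `u(-x)`.
[cite: JacquetShalikaAJM1981, §3, (3.5)] -/
def archColGL (x : Fin m → R) : GL (Fin (m + 1)) R where
  val := 1 + lastColMatrix x
  inv := 1 + lastColMatrix (-x)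
  val_inv := by rw [one_add_lastColMatrix_mul, add_neg_cancel, lastColMatrix_zero, add_zero]
  inv_val := by rw [one_add_lastColMatrix_mul, neg_add_cancel, lastColMatrix_zero, add_zero]

/-- The underlying matrix of `u(x)`. [folklore] -/
@[simp] theorem coe_archColGL (x : Fin m → R) :
    ((archColGL x : GL (Fin (m + 1)) R) : Matrix (Fin (m + 1)) (Fin (m + 1)) R) = 1 + lastColMatrix x := rfl

/-- `u(0) = 1`. [folklore] -/
@[simp] theorem archColGL_zero : archColGL (0 : Fin m → R) = 1 :=
  Units.ext (by simp)

/-- `u(x + y) = u(x) u(y)`. [folklore] -/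
theorem archColGL_add (x y : Fin m → R) : archColGL (x + y) = archColGL x * archColGL y :=
  Units.ext (by rw [Units.val_mul, coe_archColGL, coe_archColGL, coe_archColGL, one_add_lastColMatrix_mul])

/-- **The corner conjugates the column through the standard action**:
`diag(g, 1) N(x) = N(g x)` at the level of matrices. [folklore] -/
theorem cornerSuccMatrix_mul_lastColMatrix (g : Matrix (Fin m) (Fin m) R) (x : Fin m → R) :
    cornerSuccMatrix g * lastColMatrix x = lastColMatrix (g *ᵥ x) := by
  ext i j
  rw [Matrix.mul_apply]
  by_cases hj : j = Fin.last m
  · subst hj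
    rw [Fin.sum_univ_castSucc, lastColMatrix_last, mul_zero, add_zero]
    induction i using Fin.lastCases with
    | last =>
      rw [lastColMatrix_last]
      refine Finset.sum_eq_zero fun k _ => ?_
      rw [cornerSuccMatrix_apply_last_castSucc, zero_mul]
    | cast i =>
      rw [lastColMatrix_castSucc_last, Matrix.mulVec, dotProduct]
      refine Finset.sum_congr rfl fun k _ => ?_
      rw [cornerSuccMatrix_apply_castSucc_castSucc, lastColMatrix_castSucc_last]
  · rw [lastColMatrix_apply_of_ne _ i hj]
    refine Finset.sum_eq_zero fun k _ => ?_
    rw [lastColMatrix_apply_of_ne x k hj, mul_zero]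

/-- `N(x) diag(g, 1) = N(x)` at the level of matrices (the last row of `diag(g,1)` is `e_{m+1}`).
[folklore] -/
theorem lastColMatrix_mul_cornerSuccMatrix (g : Matrix (Fin m) (Fin m) R) (x : Fin m → R) :
    lastColMatrix x * cornerSuccMatrix g = lastColMatrix x := by
  ext i j
  rw [Matrix.mul_apply, Fin.sum_univ_castSucc]
  have h0 : ∑ k : Fin m, lastColMatrix x i k.castSucc * cornerSuccMatrix g k.castSucc j = 0 :=
    Finset.sum_eq_zero fun k _ => by rw [lastColMatrix_apply_of_ne x i (Fin.castSucc_ne_last k), zero_mul]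
  rw [h0, zero_add]
  induction j using Fin.lastCases with
  | last => rw [cornerSuccMatrix_apply_last_last, mul_one]
  | cast j => rw [cornerSuccMatrix_apply_last_castSucc, mul_zero, lastColMatrix_apply_of_ne x i (Fin.castSucc_ne_last j)]

/-- **`diag(g, 1) u(x) diag(g, 1)⁻¹ = u(g x)`**: the corner `GL_m` acts on the column group by the
standard representation. [cite: JacquetShalikaAJM1981, §3, (3.5)] -/
theorem cornerSucc_mul_archColGL_mul_inv (g : GL (Fin m) R) (x : Fin m → R) :
    GLn.cornerSucc R g * archColGL x * (GLn.cornerSucc R g)⁻¹ =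
      archColGL ((g : Matrix (Fin m) (Fin m) R) *ᵥ x) := by
  rw [mul_inv_eq_iff_eq_mul]
  refine Units.ext ?_
  rw [Units.val_mul, Units.val_mul, coe_archColGL, coe_archColGL, mul_add, add_mul, mul_one, one_mul,
    add_right_inj]
  change cornerSuccMatrix (g : Matrix (Fin m) (Fin m) R) * lastColMatrix x =
    lastColMatrix ((g : Matrix (Fin m) (Fin m) R) *ᵥ x) * cornerSuccMatrix (g : Matrix (Fin m) (Fin m) R)
  rw [cornerSuccMatrix_mul_lastColMatrix, lastColMatrix_mul_cornerSuccMatrix]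

/-- Equivalently `diag(g,1)⁻¹ u(x) diag(g,1) = u(g⁻¹ x)`. [folklore] -/
theorem cornerSucc_inv_mul_archColGL_mul (g : GL (Fin m) R) (x : Fin m → R) :
    (GLn.cornerSucc R g)⁻¹ * archColGL x * GLn.cornerSucc R g =
      archColGL (((g⁻¹ : GL (Fin m) R) : Matrix (Fin m) (Fin m) R) *ᵥ x) := by
  have h := cornerSucc_mul_archColGL_mul_inv g⁻¹ x
  rwa [map_inv, inv_inv] at h

end Matrices

/-! ### 2. The unitary representation of the column -/

section ColumnRep

/-- `x ↦ u(x)` is continuous over a topological ring. [folklore] -/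
theorem continuous_archColGL {R : Type*} [CommRing R] [TopologicalSpace R] [IsTopologicalRing R] :
    Continuous (archColGL : (Fin m → R) → GL (Fin (m + 1)) R) := by
  have hN : Continuous fun x : Fin m → R => lastColMatrix x := by
    refine continuous_matrix fun i j => ?_
    by_cases h : i ≠ Fin.last m ∧ j = Fin.last m
    · simp only [lastColMatrix, Matrix.of_apply, dif_pos h]
      exact continuous_apply _
    · simp only [lastColMatrix, Matrix.of_apply, dif_neg h]
      exact continuous_const
  refine Units.continuous_iff.2 ⟨?_, ?_⟩
  · exact continuous_const.add hN
  · change Continuous fun x : Fin m → R => (1 : Matrix (Fin (m + 1)) (Fin (m + 1)) R) + lastColMatrix (-x)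
    exact continuous_const.add (hN.comp continuous_neg)

variable (hcpt : isCompact_glFiniteIntegralLevel (m + 1) K)
  {E : Type*} [NormedAddCommGroup E] [InnerProductSpace ℂ E] [CompleteSpace E]
  {τ : ContRepresentation ℂ (AutomorphyDatum.gl (m + 1) K hcpt).arch.carrier E}

/-- **`x ↦ u(x)` as a continuous homomorphism** from the additive group `K_∞^m` into
`G_∞ = GL_{m+1}(K_∞)`. [folklore] -/
def archColHom : Multiplicative (Fin m → mixedSpace K) →ₜ* (AutomorphyDatum.gl (m + 1) K hcpt).arch.carrier where
  toFun x := toArch hcpt (archColGL x.toAdd)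
  map_one' := Subtype.ext (by change archColGL (0 : Fin m → mixedSpace K) = 1; exact archColGL_zero)
  map_mul' x y := Subtype.ext (by
    change archColGL (x.toAdd + y.toAdd) = archColGL x.toAdd * archColGL y.toAdd
    exact archColGL_add _ _)
  continuous_toFun := (continuous_archColGL.comp continuous_toAdd).subtype_mk _

/-- `archColHom (ofAdd x) = u(x)`. [folklore] -/
@[simp] theorem archColHom_apply (x : Fin m → mixedSpace K) :
    archColHom hcpt (Multiplicative.ofAdd x) = toArch hcpt (archColGL x) := rfl

variable {hcpt}

/-- **The column representation of `τ`**: the unitary representation `x ↦ τ(u(x))` of the additive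
group `K_∞^m` (the restriction of `τ` to the unipotent radical `U_{m+1}` of the mirabolic).
[cite: JacquetShalikaAJM1981, §3, (3.5)] -/
def archColRep (hτ : τ.IsStronglyContinuous) (hτu : τ.IsUnitary) :
    UnitaryRep (Multiplicative (Fin m → mixedSpace K)) E :=
  (τ.toUnitaryRep hτ hτu).restrict (archColHom hcpt)

/-- `archColRep (ofAdd x) = τ(u(x))`. [folklore] -/
@[simp] theorem archColRep_apply (hτ : τ.IsStronglyContinuous) (hτu : τ.IsUnitary) (x : Fin m → mixedSpace K) :
    archColRep hτ hτu (Multiplicative.ofAdd x) = τ (toArch hcpt (archColGL x)) := rfl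

/-- **Matrix coefficients at a corner translate are twisted by the standard action**:
`⟪τ(diag(g,1)) v, τ(u(x)) τ(diag(g,1)) v⟫ = ⟪v, τ(u(g⁻¹ x)) v⟫`. [cite: Folland1995, Thm. 4.44] -/
theorem matrixCoeff_archColRep_cornerSucc (hτ : τ.IsStronglyContinuous) (hτu : τ.IsUnitary)
    (g : GL (Fin m) (mixedSpace K)) (v : E) (x : Fin m → mixedSpace K) :
    (archColRep hτ hτu).matrixCoeff (τ (toArch hcpt (GLn.cornerSucc (mixedSpace K) g)) v)
        (τ (toArch hcpt (GLn.cornerSucc (mixedSpace K) g)) v) x =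
      (archColRep hτ hτu).matrixCoeff v v (((g⁻¹ : GL (Fin m) (mixedSpace K)) : Matrix (Fin m) (Fin m) (mixedSpace K)) *ᵥ x) := by
  rw [UnitaryRep.matrixCoeff_apply, UnitaryRep.matrixCoeff_apply, archColRep_apply, archColRep_apply]
  set c : (AutomorphyDatum.gl (m + 1) K hcpt).arch.carrier := toArch hcpt (GLn.cornerSucc (mixedSpace K) g)
  have hconj : τ (toArch hcpt (archColGL x)) (τ c v) =
      τ c (τ (toArch hcpt (archColGL (((g⁻¹ : GL (Fin m) (mixedSpace K)) : Matrix (Fin m) (Fin m) (mixedSpace K)) *ᵥ x))) v) := by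
    rw [← ContinuousLinearMap.comp_apply, ← ContinuousLinearMap.mul_def, ← map_mul,
      ← ContinuousLinearMap.comp_apply (τ c), ← ContinuousLinearMap.mul_def, ← map_mul]
    congr 2
    refine Subtype.ext ?_
    change archColGL x * GLn.cornerSucc (mixedSpace K) g =
      GLn.cornerSucc (mixedSpace K) g * archColGL (((g⁻¹ : GL (Fin m) (mixedSpace K)) : Matrix (Fin m) (Fin m) (mixedSpace K)) *ᵥ x)
    rw [← cornerSucc_inv_mul_archColGL_mul g x, ← mul_assoc, ← mul_assoc, mul_inv_cancel, one_mul]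
  rw [hconj]
  exact (τ.toUnitaryRep hτ hτu).inner_map_map c v _

end ColumnRep

/-! ### 3. The character form of `K_∞^m` and the covariance of spectral measures -/

section Form

variable (K m)

/-- **The character form of `K_∞^m`**: `B_m(ξ, x) = Σ_i B(ξ_i, x_i)` with `B = archCharForm K`
(`= -2π Tr_{K_∞/ℝ}(ξ_i x_i)`), pairing ROW vectors `ξ` with COLUMN vectors `x`; the characters of the
additive group `K_∞^m` are `x ↦ exp(i B_m(ξ, x))`. [cite: Folland1995, Thm. 4.44] -/
def archColForm : LinearMap.BilinForm ℝ (Fin m → mixedSpace K) :=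
  ∑ i : Fin m, (archCharForm K).compl₁₂ (LinearMap.proj i : (Fin m → mixedSpace K) →ₗ[ℝ] mixedSpace K)
    (LinearMap.proj i : (Fin m → mixedSpace K) →ₗ[ℝ] mixedSpace K)

variable {K m}

/-- Unfolding of `archColForm`. [folklore] -/
theorem archColForm_apply (ξ x : Fin m → mixedSpace K) :
    archColForm K m ξ x = ∑ i, archCharForm K (ξ i) (x i) := by
  simp [archColForm, LinearMap.sum_apply]

/-- **`B_m` is non-degenerate** (coordinatewise from `archCharForm_nondegenerate`). [folklore] -/
theorem archColForm_nondegenerate : (archColForm K m).Nondegenerate := by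
  have hnd := archCharForm_nondegenerate (K := K)
  refine ⟨fun ξ h => funext fun i => hnd.1 (ξ i) fun y => ?_, fun x h => funext fun i => hnd.2 (x i) fun y => ?_⟩
  · have := h (Pi.single i y)
    rw [archColForm_apply, Finset.sum_eq_single i (fun j _ hj => by rw [Pi.single_eq_of_ne hj, map_zero])
      (fun hi => absurd (Finset.mem_univ i) hi), Pi.single_eq_same] at this
    exact this
  · have := h (Pi.single i y)
    rw [archColForm_apply, Finset.sum_eq_single i (fun j _ hj => by
      rw [Pi.single_eq_of_ne hj, LinearMap.map_zero₂]) (fun hi => absurd (Finset.mem_univ i) hi),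
      Pi.single_eq_same] at this
    exact this

/-- **`B_m(ξ, A x) = B_m(ξ A, x)`**: the `B_m`-adjoint of the column action `x ↦ A x` of a matrix is the
row action `ξ ↦ ξ A` (`K_∞` is commutative: `B(ξ, a x) = B(a ξ, x)`). [folklore] -/
theorem archColForm_mulVec (A : Matrix (Fin m) (Fin m) (mixedSpace K)) (ξ x : Fin m → mixedSpace K) :
    archColForm K m ξ (A *ᵥ x) = archColForm K m (ξ ᵥ* A) x := by
  have hL : archColForm K m ξ (A *ᵥ x) = ∑ i, ∑ j, archCharForm K (A i j * ξ i) (x j) := by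
    rw [archColForm_apply]
    refine Finset.sum_congr rfl fun i _ => ?_
    rw [Matrix.mulVec, dotProduct, map_sum]
    refine Finset.sum_congr rfl fun j _ => ?_
    rw [archCharForm_mul_left]
  have hR : archColForm K m (ξ ᵥ* A) x = ∑ j, ∑ i, archCharForm K (ξ i * A i j) (x j) := by
    rw [archColForm_apply]
    refine Finset.sum_congr rfl fun j _ => ?_
    rw [Matrix.vecMul, dotProduct, map_sum, LinearMap.sum_apply]
  rw [hL, hR, Finset.sum_comm]
  exact Finset.sum_congr rfl fun j _ => Finset.sum_congr rfl fun i _ => by rw [mul_comm]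

/-- The column action `x ↦ A x` as a real linear map. [folklore] -/
def colMulVecLin (A : Matrix (Fin m) (Fin m) (mixedSpace K)) : (Fin m → mixedSpace K) →ₗ[ℝ] (Fin m → mixedSpace K) :=
  (Matrix.mulVecLin A).restrictScalars ℝ

/-- The row action `ξ ↦ ξ A` as a real linear map. [folklore] -/
def rowVecMulLin (A : Matrix (Fin m) (Fin m) (mixedSpace K)) : (Fin m → mixedSpace K) →ₗ[ℝ] (Fin m → mixedSpace K) :=
  (Matrix.vecMulLinear A).restrictScalars ℝ

omit [NumberField K] in
/-- Unfolding of `colMulVecLin`. [folklore] -/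
@[simp] theorem colMulVecLin_apply (A : Matrix (Fin m) (Fin m) (mixedSpace K)) (x : Fin m → mixedSpace K) :
    colMulVecLin A x = A *ᵥ x := rfl

omit [NumberField K] in
/-- Unfolding of `rowVecMulLin`. [folklore] -/
@[simp] theorem rowVecMulLin_apply (A : Matrix (Fin m) (Fin m) (mixedSpace K)) (ξ : Fin m → mixedSpace K) :
    rowVecMulLin A ξ = ξ ᵥ* A := rfl

/-- The Borel structure of `K_∞^m` (recorded as a theorem and local instance: instance search does not
assemble it by itself here). [folklore] -/
theorem borelSpace_pi_mixedSpace (m : ℕ) : BorelSpace (Fin m → mixedSpace K) := by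
  haveI : BorelSpace (mixedSpace K) := inferInstance
  exact Pi.borelSpace

attribute [local instance] borelSpace_pi_mixedSpace

variable {hcpt : isCompact_glFiniteIntegralLevel (m + 1) K}
  {E : Type*} [NormedAddCommGroup E] [InnerProductSpace ℂ E] [CompleteSpace E]
  {τ : ContRepresentation ℂ (AutomorphyDatum.gl (m + 1) K hcpt).arch.carrier E}

/-- **Covariance of the column spectral measures under the corner**: the Stone–Bochner spectral
measure (for the form `B_m`) of `τ(diag(g,1)) v` under the column group is the push-forward of that
of `v` under the row action `ξ ↦ ξ g⁻¹`. This is the system of imprimitivity `GL_m ↷ \widehat{K_∞^m}`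
of the mirabolic `P_{m+1} = GL_m ⋉ K_∞^m` inside `τ`. [cite: Folland1995, Thm. 4.44 and §6.4]
[cite: JacquetShalikaAJM1981, §3, (3.5)–(3.7)] -/
theorem spectralMeasure_archColRep_cornerSucc (hτ : τ.IsStronglyContinuous) (hτu : τ.IsUnitary)
    (g : GL (Fin m) (mixedSpace K)) (v : E) :
    (archColRep hτ hτu).spectralMeasure (archColForm K m) archColForm_nondegenerate
        (τ (toArch hcpt (GLn.cornerSucc (mixedSpace K) g)) v) =
      ((archColRep hτ hτu).spectralMeasure (archColForm K m) archColForm_nondegenerate v).map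
        (rowVecMulLin (((g⁻¹ : GL (Fin m) (mixedSpace K)) : Matrix (Fin m) (Fin m) (mixedSpace K)))) :=
  (archColRep hτ hτu).spectralMeasure_eq_map_of_matrixCoeff_eq (archColForm K m) archColForm_nondegenerate v _
    (colMulVecLin (((g⁻¹ : GL (Fin m) (mixedSpace K)) : Matrix (Fin m) (Fin m) (mixedSpace K))))
    (rowVecMulLin (((g⁻¹ : GL (Fin m) (mixedSpace K)) : Matrix (Fin m) (Fin m) (mixedSpace K))))
    (fun ξ x => by rw [rowVecMulLin_apply, colMulVecLin_apply, archColForm_mulVec])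
    (fun x => by rw [colMulVecLin_apply]; exact matrixCoeff_archColRep_cornerSucc hτ hτu g v x)

/-- **Plancherel under the corner twist**: for `f ∈ L¹`,
`‖∫ f(x) τ(u(x)) τ(diag(g,1)) v dλ‖² = ∫ |∫ f(x) exp(i B_m(ξ g⁻¹, x)) dλ(x)|² dμ_v(ξ)` — the norm of a
column-smoothing of a corner translate is read on the spectral measure of `v` with the kernel's
transform DILATED by `g`. [cite: Folland1995, Thm. 4.44] -/
theorem norm_sq_integral_smul_archColRep_cornerSucc (hτ : τ.IsStronglyContinuous) (hτu : τ.IsUnitary)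
    (g : GL (Fin m) (mixedSpace K)) (v : E) (lam : Measure (Fin m → mixedSpace K)) [SFinite lam]
    {f : (Fin m → mixedSpace K) → ℂ} (hf : Integrable f lam) :
    ‖∫ x, f x • archColRep hτ hτu (Multiplicative.ofAdd x) (τ (toArch hcpt (GLn.cornerSucc (mixedSpace K) g)) v) ∂lam‖ ^ 2 =
      ∫ ξ, ‖∫ x, f x * Complex.exp ((archColForm K m
          (ξ ᵥ* (((g⁻¹ : GL (Fin m) (mixedSpace K)) : Matrix (Fin m) (Fin m) (mixedSpace K)))) x : ℝ) * Complex.I) ∂lam‖ ^ 2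
        ∂((archColRep hτ hτu).spectralMeasure (archColForm K m) archColForm_nondegenerate v) := by
  have h := (archColRep hτ hτu).norm_sq_integral_smul_map_eq_of_matrixCoeff_eq (archColForm K m)
    archColForm_nondegenerate v _
    (colMulVecLin (((g⁻¹ : GL (Fin m) (mixedSpace K)) : Matrix (Fin m) (Fin m) (mixedSpace K))))
    (rowVecMulLin (((g⁻¹ : GL (Fin m) (mixedSpace K)) : Matrix (Fin m) (Fin m) (mixedSpace K))))
    (fun ξ x => by rw [rowVecMulLin_apply, colMulVecLin_apply, archColForm_mulVec])
    (fun x => by rw [colMulVecLin_apply]; exact matrixCoeff_archColRep_cornerSucc hτ hτu g v x) lam hf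
  simpa only [rowVecMulLin_apply] using h

end Form

end Literature.NumberTheory.Automorphic

end
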